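import Summits.QuantumAdvantage.QuantumAdvantage.Theorems.CubicForrelationNearExactIsExactCubicFormFibre
import Summits.QuantumAdvantage.QuantumAdvantage.Theorems.CubicForrelationNearExactIsExactCubicFormRadical

/-!
# Crux `CubicForrelation.NearExactIsExact` (stmt-QuantumAdvantage-14043) — the `h = 0` MENU of a `T`-cell (all fibres affine):
  `wt f ≥ 32 · #{u : Q_u non-constant}`, and the non-constant fibres are none, or at least four

Certificate seat `b2b-cforr-cert` (gen 41).  HONEST FRAMING: kernel-checked counting (standard axioms) — the case `h = 0` of cell lemma L-T
(HOME/b2b-cforr-cert-g39/E1280-HANDPROOFS.md App. A.3): for a cell `f = y₀y₁y₂ ⊕ Q` on `3 + 6` bits (…CubicFormFibre) whose fibres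
`Q_u = Q(u,·)` have vanishing second differences (the fibre form `β_FF` is `0`), each fibre is affine, so has `0`, `32` or `64` ones
(…CubicFormRadical `tce_affine_dichotomy`), and the fibre formula gives `wt f ≥ 32 · N` with `N` the number of non-constant fibres; the
constant fibres form an affinely closed subset `Z ⊆ 𝔽₂³`, hence `#Z = 8` or `#Z ≤ 4`, i.e. `N = 0` or `N ≥ 4`:  `M(0, r̄ ≥ 1) ≥ 128`.
(The finer `M(0, r̄ ≥ 2) ≥ 192` and the `h = 1` menu are not in this file.)  Nothing about `θ₁₂`; NOT summit progress.

* `tfa_affine_closed_card`: an affinely closed proper subset of `𝔽₂³` has at most `4` elements.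
* `tfa_T_menu_h0` (**main**): `32 · N ≤ #f` and (`N = 0 ∨ 4 ≤ N`).

References: E1280-HANDPROOFS.md App. A.3.  Axioms: the standard three.
-/

set_option linter.dupNamespace false -- D-0017: single-problem summit ⇒ `QuantumAdvantage.QuantumAdvantage` by design

namespace Summit.QuantumAdvantage.QuantumAdvantage.Theorems.CubicForrelation.NearExactIsExact

open Finset
open Literature.Computability.QuantumComplexity.BuzetChailloux (bxor zeroVec allOnes bxor_comm bxor_self bxor_zeroVec zeroVec_bxor
  bxor_bxor_cancel_left)

/-- **An affinely closed proper subset of `𝔽₂³` has at most four elements** (pigeonhole: a set of `≥ 5` points and its translate meet).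
[folklore] -/
theorem tfa_affine_closed_card (Z : Finset (Fin 3 → Bool)) (hZ : ∀ a ∈ Z, ∀ b ∈ Z, ∀ c ∈ Z, bxor a (bxor b c) ∈ Z) :
    Z = univ ∨ #Z ≤ 4 := by
  classical
  by_cases h4 : #Z ≤ 4
  · exact Or.inr h4
  · left
    rw [eq_univ_iff_forall]
    intro u
    obtain ⟨z₀, hz₀⟩ : Z.Nonempty := by rw [← card_pos]; omega
    -- the translate `u ⊕ z₀ ⊕ Z` meets `Z`
    have hinj : Function.Injective (fun z : Fin 3 → Bool => bxor u (bxor z₀ z)) := by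
      intro a b hab
      have e := congrArg (fun x => bxor z₀ (bxor u x)) hab
      simp only [bxor_bxor_cancel_left] at e
      exact e
    have hcard : #(Z.image fun z => bxor u (bxor z₀ z)) = #Z := card_image_of_injective _ hinj
    have hmeet : ¬ Disjoint (Z.image fun z => bxor u (bxor z₀ z)) Z := by
      intro hdis
      have e := card_union_of_disjoint hdis
      have hle : #((Z.image fun z => bxor u (bxor z₀ z)) ∪ Z) ≤ 8 := by
        refine (card_le_univ _).trans ?_
        rw [Fintype.card_fun, Fintype.card_bool, Fintype.card_fin]; norm_num
      rw [e, hcard] at hle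
      omega
    rw [not_disjoint_iff] at hmeet
    obtain ⟨w, hw1, hw2⟩ := hmeet
    obtain ⟨z, hz, rfl⟩ := mem_image.1 hw1
    -- `u = (u ⊕ z₀ ⊕ z) ⊕ z₀ ⊕ z ∈ Z`
    have e : u = bxor (bxor u (bxor z₀ z)) (bxor z₀ z) := by
      rw [iw_bxor_assoc, bxor_self, bxor_zeroVec]
    rw [e]
    exact hZ _ hw2 _ hz₀ _ hz

/-- **The `h = 0` menu of a `T`-cell.**  See the module docstring. [this work] -/
theorem tfa_T_menu_h0 (f : (Fin (3 + 6) → Bool) → Bool)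
    (hT : ∀ u v w x : Fin (3 + 6) → Bool,
      (((f x ^^ f (bxor x w)) ^^ (f (bxor x v) ^^ f (bxor (bxor x v) w))) ^^
          ((f (bxor x u) ^^ f (bxor (bxor x u) w)) ^^ (f (bxor (bxor x u) v) ^^ f (bxor (bxor (bxor x u) v) w)))) =
        ((((u (Fin.castAdd 6 0) && (v (Fin.castAdd 6 1) && w (Fin.castAdd 6 2))) ^^
              (u (Fin.castAdd 6 0) && (v (Fin.castAdd 6 2) && w (Fin.castAdd 6 1)))) ^^
            ((u (Fin.castAdd 6 1) && (v (Fin.castAdd 6 0) && w (Fin.castAdd 6 2))) ^^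
              (u (Fin.castAdd 6 1) && (v (Fin.castAdd 6 2) && w (Fin.castAdd 6 0))))) ^^
          ((u (Fin.castAdd 6 2) && (v (Fin.castAdd 6 0) && w (Fin.castAdd 6 1))) ^^
            (u (Fin.castAdd 6 2) && (v (Fin.castAdd 6 1) && w (Fin.castAdd 6 0))))))
    (hFF : ∀ (t : Fin 3 → Bool) (v w x : Fin 6 → Bool),
      let Qt : (Fin 6 → Bool) → Bool := fun s =>
        f (Fin.append t s) ^^ (((Fin.append t s) (Fin.castAdd 6 0) && (Fin.append t s) (Fin.castAdd 6 1)) && (Fin.append t s) (Fin.castAdd 6 2))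
      ((Qt x ^^ Qt (bxor x w)) ^^ (Qt (bxor x v) ^^ Qt (bxor (bxor x v) w))) = false) :
    let Qf : (Fin 3 → Bool) → (Fin 6 → Bool) → Bool := fun t s =>
      f (Fin.append t s) ^^ (((Fin.append t s) (Fin.castAdd 6 0) && (Fin.append t s) (Fin.castAdd 6 1)) && (Fin.append t s) (Fin.castAdd 6 2))
    let N : ℕ := #(univ.filter fun t : Fin 3 → Bool => ∃ s, Qf t s ≠ Qf t zeroVec)
    32 * N ≤ #(univ.filter fun y : Fin (3 + 6) → Bool => f y = true) ∧ (N = 0 ∨ 4 ≤ N) := by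
  classical
  intro Qf N
  obtain ⟨-, hfib⟩ := tfb_fibre_formula f hT
  have hfib' : #(univ.filter fun y : Fin (3 + 6) → Bool => f y = true) + #(univ.filter fun s : Fin 6 → Bool => Qf allOnes s = true) =
      (∑ v ∈ (univ : Finset (Fin 3 → Bool)).erase allOnes, #(univ.filter fun s : Fin 6 → Bool => Qf v s = true)) + 2 ^ 6 := hfib
  -- every fibre is affine: `0`, `32` or `64` ones; non-constant ⇒ exactly `32`
  have haff : ∀ t : Fin 3 → Bool, ∀ x y z : Fin 6 → Bool, Qf t (bxor x (bxor y z)) = ((Qf t x ^^ Qf t y) ^^ Qf t z) := by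
    intro t x y z
    have e1 := hFF t y z x
    have e2 := hFF t x z zeroVec
    have e3 := hFF t x y zeroVec
    simp only [zeroVec_bxor] at e1 e2 e3
    change ((Qf t x ^^ Qf t (bxor x z)) ^^ (Qf t (bxor x y) ^^ Qf t (bxor (bxor x y) z))) = false at e1
    change ((Qf t zeroVec ^^ Qf t z) ^^ (Qf t x ^^ Qf t (bxor x z))) = false at e2
    change ((Qf t zeroVec ^^ Qf t y) ^^ (Qf t x ^^ Qf t (bxor x y))) = false at e3
    rw [show bxor x (bxor y z) = bxor (bxor x y) z by rw [iw_bxor_assoc]]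
    revert e1 e2 e3
    cases Qf t zeroVec <;> cases Qf t x <;> cases Qf t y <;> cases Qf t z <;> cases Qf t (bxor x z) <;> cases Qf t (bxor x y) <;>
      cases Qf t (bxor (bxor x y) z) <;> decide
  have htri : ∀ t : Fin 3 → Bool, #(univ.filter fun s : Fin 6 → Bool => Qf t s = true) = 0 ∨
      2 * #(univ.filter fun s : Fin 6 → Bool => Qf t s = true) = 64 ∨ #(univ.filter fun s : Fin 6 → Bool => Qf t s = true) = 64 := by
    intro t
    have e := tce_affine_dichotomy (univ : Finset (Fin 6 → Bool)) (Qf t) (fun x _ y _ z _ => mem_univ _) (fun x _ y _ z _ => haff t x y z)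
    rw [card_univ, Fintype.card_fun, Fintype.card_bool, Fintype.card_fin] at e
    exact e
  have hnc : ∀ t : Fin 3 → Bool, (∃ s, Qf t s ≠ Qf t zeroVec) → #(univ.filter fun s : Fin 6 → Bool => Qf t s = true) = 32 := by
    intro t ⟨s, hs⟩
    rcases htri t with h0 | h1 | h2
    · exfalso
      rw [card_eq_zero, filter_eq_empty_iff] at h0
      have a := h0 (mem_univ s); have b := h0 (mem_univ zeroVec)
      revert hs a b; cases Qf t s <;> cases Qf t zeroVec <;> simp
    · omega
    · exfalso
      have hall : ∀ x, Qf t x = true := by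
        intro x
        have hU : (univ.filter fun s : Fin 6 → Bool => Qf t s = true) = univ :=
          Finset.eq_of_subset_of_card_le (filter_subset _ _)
            (by rw [h2, card_univ, Fintype.card_fun, Fintype.card_bool, Fintype.card_fin]; norm_num)
        have : x ∈ univ.filter fun s : Fin 6 → Bool => Qf t s = true := by rw [hU]; exact mem_univ x
        exact (mem_filter.1 this).2
      exact hs (by rw [hall s, hall zeroVec])
  have hcst : ∀ t : Fin 3 → Bool, (¬ ∃ s, Qf t s ≠ Qf t zeroVec) →
      #(univ.filter fun s : Fin 6 → Bool => Qf t s = true) = 0 ∨ #(univ.filter fun s : Fin 6 → Bool => Qf t s = true) = 64 := by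
    intro t hn
    rcases htri t with h0 | h1 | h2
    · exact Or.inl h0
    · exfalso
      push Not at hn
      -- constant fibre: all values equal `Qf t 0`, so the count is `0` or `64`
      cases h00 : Qf t zeroVec
      · have : #(univ.filter fun s : Fin 6 → Bool => Qf t s = true) = 0 := by
          rw [card_eq_zero, filter_eq_empty_iff]; intro s _; rw [hn s, h00]; exact Bool.false_ne_true
        omega
      · have : (univ.filter fun s : Fin 6 → Bool => Qf t s = true) = univ := filter_true_of_mem fun s _ => by rw [hn s, h00]
        rw [this, card_univ, Fintype.card_fun, Fintype.card_bool, Fintype.card_fin] at h1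
        norm_num at h1
    · exact Or.inr h2
  -- the weight bound
  refine ⟨?_, ?_⟩
  · -- sum over `u ≠ 111` of `32·[non-constant]`, plus the `111` term
    have hterm : ∀ t : Fin 3 → Bool, 32 * (if (∃ s, Qf t s ≠ Qf t zeroVec) then 1 else 0) ≤ #(univ.filter fun s : Fin 6 → Bool => Qf t s = true) := by
      intro t
      by_cases hx : ∃ s, Qf t s ≠ Qf t zeroVec
      · rw [if_pos hx, hnc t hx]
      · rw [if_neg hx]; exact Nat.zero_le _
    have hsum : 32 * (∑ t ∈ (univ : Finset (Fin 3 → Bool)).erase allOnes, (if (∃ s, Qf t s ≠ Qf t zeroVec) then 1 else 0)) ≤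
        ∑ t ∈ (univ : Finset (Fin 3 → Bool)).erase allOnes, #(univ.filter fun s : Fin 6 → Bool => Qf t s = true) := by
      rw [mul_sum]; exact sum_le_sum fun t _ => hterm t
    have hN : N = (∑ t ∈ (univ : Finset (Fin 3 → Bool)).erase allOnes, (if (∃ s, Qf t s ≠ Qf t zeroVec) then 1 else 0)) +
        (if (∃ s, Qf allOnes s ≠ Qf allOnes zeroVec) then 1 else 0) := by
      simp only [N, card_filter]
      rw [← Finset.sum_erase_add _ _ (mem_univ allOnes)]
    have h111 : 32 * (if (∃ s, Qf allOnes s ≠ Qf allOnes zeroVec) then 1 else 0) + #(univ.filter fun s : Fin 6 → Bool => Qf allOnes s = true) ≤ 64 := by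
      by_cases hx : ∃ s, Qf allOnes s ≠ Qf allOnes zeroVec
      · rw [if_pos hx, hnc allOnes hx]
      · rw [if_neg hx]
        rcases hcst allOnes hx with h0 | h64 <;> omega
    simp only [Nat.reducePow] at hfib'
    rw [hN]
    omega
  · -- the constant fibres are affinely closed
    set Z := univ.filter fun t : Fin 3 → Bool => ¬ ∃ s, Qf t s ≠ Qf t zeroVec with hZdef
    have hℓ : ∀ (t a : Fin 3 → Bool) (s : Fin 6 → Bool), (Qf (bxor t a) s ^^ Qf (bxor t a) zeroVec) =
        ((Qf t s ^^ Qf t zeroVec) ^^ (Qf a s ^^ Qf a zeroVec) ^^ (Qf zeroVec s ^^ Qf zeroVec zeroVec)) := by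
      -- the mixed second difference is base-point free: the cubic form `T` vanishes when one argument has no `U`-part
      intro t a s
      have e := hT (Fin.append t zeroVec) (Fin.append a zeroVec) (Fin.append zeroVec s)
        (Fin.append (zeroVec : Fin 3 → Bool) (zeroVec : Fin 6 → Bool))
      have hz3 : ∀ k, (zeroVec : Fin 3 → Bool) k = false := fun k => rfl
      simp only [tcc_append_bxor, bxor_zeroVec, zeroVec_bxor, Fin.append_left, hz3, Bool.and_false, Bool.xor_false] at e
      simp only [Qf, Fin.append_left]
      revert e
      generalize f (Fin.append (bxor t a) s) = A₁
      generalize f (Fin.append (bxor t a) zeroVec) = A₂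
      generalize f (Fin.append t s) = A₃
      generalize f (Fin.append t zeroVec) = A₄
      generalize f (Fin.append a s) = A₅
      generalize f (Fin.append a zeroVec) = A₆
      generalize f (Fin.append zeroVec s) = A₇
      generalize f (Fin.append zeroVec zeroVec) = A₈
      generalize ((bxor t a 0 && bxor t a 1) && bxor t a 2) = M₁
      generalize ((t 0 && t 1) && t 2) = M₂
      generalize ((a 0 && a 1) && a 2) = M₃
      simp only [hz3, Bool.false_and, Bool.xor_false]
      revert A₁ A₂ A₃ A₄ A₅ A₆ A₇ A₈ M₁ M₂ M₃
      decide
    have hZcl : ∀ a ∈ Z, ∀ b ∈ Z, ∀ c ∈ Z, bxor a (bxor b c) ∈ Z := by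
      intro a ha b hb c hc
      have ha' := (mem_filter.1 ha).2; have hb' := (mem_filter.1 hb).2; have hc' := (mem_filter.1 hc).2
      push Not at ha' hb' hc'
      refine mem_filter.2 ⟨mem_univ _, ?_⟩
      push Not
      intro s
      have e1 := hℓ a (bxor b c) s
      have e2 := hℓ b c s
      have key : (Qf (bxor a (bxor b c)) s ^^ Qf (bxor a (bxor b c)) zeroVec) = false := by
        rw [e1, e2, ha' s, hb' s, hc' s]
        generalize Qf a zeroVec = pa
        generalize Qf b zeroVec = pb
        generalize Qf c zeroVec = pc
        generalize Qf zeroVec s = zs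
        generalize Qf zeroVec zeroVec = z0
        revert pa pb pc zs z0
        decide
      have L : ∀ x y : Bool, (x ^^ y) = false → x = y := by decide
      exact L _ _ key
    have hZN : #Z + N = 8 := by
      have e := card_filter_add_card_filter_not (s := (univ : Finset (Fin 3 → Bool))) (fun t => ∃ s, Qf t s ≠ Qf t zeroVec)
      rw [card_univ, Fintype.card_fun, Fintype.card_bool, Fintype.card_fin] at e
      change N + #Z = 2 ^ 3 at e
      omega
    rcases tfa_affine_closed_card Z hZcl with hZu | hZ4
    · left
      have : #Z = 8 := by rw [hZu, card_univ, Fintype.card_fun, Fintype.card_bool, Fintype.card_fin]; rfl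
      omega
    · right; omega

end Summit.QuantumAdvantage.QuantumAdvantage.Theorems.CubicForrelation.NearExactIsExact
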